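import Mathlib
import Literature.MathematicalPhysics.QuantumManyBody.PeriodicBoseGas
import Literature.MathematicalPhysics.QuantumManyBody.WeightedCorrector
import Literature.MathematicalPhysics.QuantumManyBody.GroundStateDirichletForm

/-!
# Sketch — crux-ideate stmt-AtomisticToContinuum-12057 (StaticResponseBound), ideator k = 1, round 1

First lemmas of the three idea cards (`Ideas/*.md`), stated over existing declarations only.
Nothing here is proved (`sorry`); the file must elaborate.

Notation. `p = 2πk/L`, `V_p(X) = ∑ⱼ cos(p·xⱼ)` (`densityCos`, the crux's observable),
`|p|² = (2π/L)² ∑ᵢ kᵢ²` (`psq`). `Θ` is a nonnegative, translation-invariant periodic trial state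
(in the cards: a minimiser of the periodic energy); the weight of `hMinusOneSqW`/`dirichletFormW` is
the real function `X ↦ ‖Θ.ψ X‖`, whose square integrates to `1` on the cell.
-/

noncomputable section

open MeasureTheory
open scoped ENNReal

namespace Summit.AtomisticToContinuum.BoseEinsteinCondensation.Cruxes.StaticResponseBound.Sketch

open Literature.MathematicalPhysics.QuantumManyBody.BoseGas

/-- The wave vector `p = (2π/L) k ∈ ℝ³` of the lattice index `k`. -/
def pvec (L : ℝ) (k : Fin 3 → ℤ) : Space :=
  WithLp.toLp 2 fun t => 2 * Real.pi / L * (k t : ℝ)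

/-- `|p|² = (2π/L)² ∑ᵢ kᵢ²` (the crux's `max` argument). -/
def psq (L : ℝ) (k : Fin 3 → ℤ) : ℝ :=
  (2 * Real.pi / L) ^ 2 * ∑ i, (k i : ℝ) ^ 2

/-- The crux's observable `V_p(X) = ∑ⱼ cos(p · xⱼ)` as a real function on configurations. -/
def densityCos (N : ℕ) (L : ℝ) (k : Fin 3 → ℤ) (X : Config N) : ℝ :=
  ∑ j : Fin N, Real.cos (2 * Real.pi / L * ∑ i, (k i : ℝ) * X j i)

/-- The real weight `X ↦ ‖Θ(X)‖` of a periodic trial state. -/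
def weight {N : ℕ} {L : ℝ} (Θ : PeriodicTrialState N L) (X : Config N) : ℝ :=
  ‖Θ.ψ X‖

/-- FORCE-DENSITY WAVE `Q(X) = ∑ⱼ sin(p·xⱼ) p̂·∇ⱼ log Θ²(X) = ∑ⱼ sin(p·xⱼ) · 2 (p̂·∇ⱼΘ)/Θ`
(card `uv-thomson-force-wave`); junk value where `Θ = 0` (it only ever appears against `Θ²`). -/
def forceWave {N : ℕ} {L : ℝ} (Θ : PeriodicTrialState N L) (k : Fin 3 → ℤ) (X : Config N) : ℝ :=
  ∑ j : Fin N, Real.sin (2 * Real.pi / L * ∑ i, (k i : ℝ) * X j i) *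
    (2 * (∑ i : Fin 3, (2 * Real.pi / L * (k i : ℝ)) / Real.sqrt (psq L k) * pderiv j i (weight Θ) X)
      / weight Θ X)

/-- CARD `fsum-sector-sandwich`, first lemma (SectorFloorToHMinusOne): a linear floor `ω` on the
sectorial Poincaré constants of `Θ²` at `±p` bounds the Kipnis–Varadhan `H₋₁` norm of the density
wave by the f-sum value `N|p|²/(2ω²)` — the `t → 0` content of StaticResponseBound, sourced from a
Landau-type sector floor (`ω = θ√(ρa)|p|` gives `N/(2θ²ρa)`). Proof idea: only the Bloch-`∓p`
components of a test function pair with `ρ_{±p}`; Cauchy–Schwarz + sector Poincaré for both factors;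
`𝓔_Θ(ρ_p) = N|p|²` (f-sum as a Dirichlet-form identity). -/
theorem sectorFloor_to_hMinusOne (N : ℕ) (L : ℝ) (hL : 0 < L) (k : Fin 3 → ℤ) (hk : k ≠ 0)
    (Θ : PeriodicTrialState N L) (hreal : ∀ X, Θ.ψ X = (‖Θ.ψ X‖ : ℂ))
    (htrans : ∀ (X : Config N) (s : Space), Θ.ψ (fun j => X j + s) = Θ.ψ X)
    (ω : ℝ) (hω : 0 < ω)
    (hfloorPos : ENNReal.ofReal ω ≤ sectorPoincareConstant L Θ.ψ (pvec L k))
    (hfloorNeg : ENNReal.ofReal ω ≤ sectorPoincareConstant L Θ.ψ (-pvec L k)) :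
    hMinusOneSqW L (weight Θ) (densityCos N L k) ≤ ENNReal.ofReal (N * psq L k / (2 * ω ^ 2)) := by
  sorry

/-- CARD `fsum-sector-sandwich`, converse brick (ResponseToHyperuniformity): the crux's
discriminant inequality at one `(N, L, k)` with constant `K` (for all states `FΘ`, `F` a periodic
test function) forces the density-wave variance of `Θ²` to be small:
`Var_{Θ²}(V_p)² ≤ K·N|p|²/8` — tested on `F = 1 + εV_p`, `ε → 0`, using `𝓔_Θ(V_p) = N|p|²/2`
(Onsager–Price–Stringari `S² ≤ m₁ m₋₁` in variational dress; with the crux's `K = 4CN/max(ρa,|p|²)`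
and `Var(V_p) = N S(p)/2` this is `S(p) ≤ √(2C)|p|/√max(ρa,|p|²)`, i.e. item TorusHyperuniformity).
Stated with the variance written as `∫ V_p² Θ²` (mean zero by translation invariance). -/
theorem response_to_hyperuniformity (N : ℕ) (L : ℝ) (hL : 0 < L) (k : Fin 3 → ℤ) (hk : k ≠ 0)
    (Θ : PeriodicTrialState N L) (hreal : ∀ X, Θ.ψ X = (‖Θ.ψ X‖ : ℂ))
    (htrans : ∀ (X : Config N) (s : Space), Θ.ψ (fun j => X j + s) = Θ.ψ X)
    (K : ℝ) (hK : 0 ≤ K)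
    (hresp : ∀ F : Config N → ℝ, IsPeriodicTest L F →
      (∫ X in cellN N L, densityCos N L k X * F X ^ 2 * weight Θ X ^ 2) ^ 2 ≤
        K * (∫ X in cellN N L, F X ^ 2 * weight Θ X ^ 2) * dirichletFormW L (weight Θ) F F) :
    (∫ X in cellN N L, densityCos N L k X ^ 2 * weight Θ X ^ 2) ^ 2 ≤ K * (N * psq L k / 8) := by
  sorry

/-- CARD `uv-thomson-force-wave`, first lemma (ThomsonFlowReduction): Thomson's (dual Dirichlet)
principle with the free displacement flow `Yⱼ = sin(p·xⱼ) p̂`: since `|p| V_p = -∇*_{Θ²}·Y - Q`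
(integration by parts on the torus) and `‖∇*Y‖₋₁ ≤ ‖Y‖_{L²(Θ²)} = √(N/2)`, any `H₋₁` bound `B` on the
force wave `Q` gives `‖V_p‖²₋₁ ≤ (√(N/2) + √B)²/|p|²` — the crux's UV constant `N/p²` is the energy of
the free flow, and the whole UV half reduces to `B ≤ C·N`. -/
theorem thomson_flow_reduction (N : ℕ) (L : ℝ) (hL : 0 < L) (k : Fin 3 → ℤ) (hk : k ≠ 0)
    (Θ : PeriodicTrialState N L) (hreal : ∀ X, Θ.ψ X = (‖Θ.ψ X‖ : ℂ))
    (hpos : ∀ X, Θ.ψ X ≠ 0)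
    (htrans : ∀ (X : Config N) (s : Space), Θ.ψ (fun j => X j + s) = Θ.ψ X)
    (B : ℝ) (hB : 0 ≤ B) (hQ : hMinusOneSqW L (weight Θ) (forceWave Θ k) ≤ ENNReal.ofReal B) :
    hMinusOneSqW L (weight Θ) (densityCos N L k) ≤
      ENNReal.ofReal ((Real.sqrt (N / 2) + Real.sqrt B) ^ 2 / psq L k) := by
  sorry

/-- CARD `transport-information-phonon-scale`, first lemma (LogSobolevToResponse): a logarithmic
Sobolev inequality for the probability measure `Θ² dX` on the `N`-particle torus with constant `κ`
(entropy `≤ (2/κ)·𝓔_Θ`) implies the crux's discriminant inequality for every state `FΘ` with constant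
`4N|p|²/κ²`, for ALL amplitudes at once (Otto–Villani `LSI ⇒ T₂`, `W₁ ≤ W₂`, Kantorovich duality with
`Lip(V_p) = √N |p|`, `∫ V_p Θ² = 0`). At the lowest mode `|p| = 2π/L`, `κ = θ √(16πρa)·2π/L` (the
PHONON gap, not `4π²/L²`) gives exactly `4N(E-E₀)/(16π θ² ρa)`. -/
theorem logSobolev_to_response (N : ℕ) (L : ℝ) (hL : 0 < L) (k : Fin 3 → ℤ) (hk : k ≠ 0)
    (Θ : PeriodicTrialState N L) (hreal : ∀ X, Θ.ψ X = (‖Θ.ψ X‖ : ℂ))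
    (htrans : ∀ (X : Config N) (s : Space), Θ.ψ (fun j => X j + s) = Θ.ψ X)
    (κ : ℝ) (hκ : 0 < κ)
    (hLSI : ∀ F : Config N → ℝ, IsPeriodicTest L F →
      (∫ X in cellN N L, F X ^ 2 * Real.log (F X ^ 2) * weight Θ X ^ 2) -
          (∫ X in cellN N L, F X ^ 2 * weight Θ X ^ 2) *
            Real.log (∫ X in cellN N L, F X ^ 2 * weight Θ X ^ 2) ≤
        2 / κ * dirichletFormW L (weight Θ) F F) :
    ∀ F : Config N → ℝ, IsPeriodicTest L F →
      (∫ X in cellN N L, densityCos N L k X * F X ^ 2 * weight Θ X ^ 2) ^ 2 ≤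
        4 * N * psq L k / κ ^ 2 * (∫ X in cellN N L, F X ^ 2 * weight Θ X ^ 2) *
          dirichletFormW L (weight Θ) F F := by
  sorry

end Summit.AtomisticToContinuum.BoseEinsteinCondensation.Cruxes.StaticResponseBound.Sketch

end
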